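import Summits.QuantumAdvantage.QuantumAdvantage.Theorems.CharDialColumnDialA1
import HarnessLib

/-!
# CharDial — the SYMMETRIC-BLOCK LAW (part A2): fibres of a coordinate block, gluing, equidistribution of the block weight

Tree twin, part A2 (§3.1), of the decomp-qadv lens-5 g34 node `Theses/ColumnDial.lean`; imports part A1.  Fibres `fib A z` of a coordinate
block, gluing (`glue`), counting inside a fibre (`card_fib`, `card_filter_fib`), zeroing on the block (`zeroOn`), and the binomial
equidistribution of the block weight modulo `3p` inside a fibre (`blockWeight_equidistributed`, `fib_weight_class_ge`, Literature
`TwoModuli.abs_card_filter_card_eq_sub_le'` BY NAME), with the two-moduli variants used by CASE I / CASE II (`fib_two_moduli_ge`,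
`fib_two_moduli_ne_ge`).
Kernel-checked, no `sorry`, no instances, no notation.  Memo: decomp-qadv-lens-5/g34/NODE-g34.md (§9 proof map, §10 land package); blueprint BLUEPRINT-g34.md.  Re-cut of the staged part A (e9ab60e3) at section boundaries (≤ 400 lines per file, every declaration docstringed); declaration bodies byte-identical.
-/

set_option autoImplicit false
set_option linter.dupNamespace false

namespace Summit.QuantumAdvantage.QuantumAdvantage.Theorems.ColumnDial

open Finset
open Summit.QuantumAdvantage.AdviceFreeQNC0

/-! ### §3 THE LAW — proof of `SymBlockLaw` (u-level; BLUEPRINT-g34 of the lens-5 g34 folder), parts 3.1–3.4 here, 3.5–3.8 in part B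

Fibres `X(z, μ) = {u : u|_{Sᶜ} = z, wt_S u ≡ μ (p)}`; cuts grouped by `κ(g) = #{s ∈ S : s < g}`; per group the score parity is a phase
pattern (§1) at the common shift `wt_S u + wt_{pre} u`; CASE I (all inner patterns vanish): a whole class `wt_S ≡ ν₀ (3)` loses; CASE II
(group `a` is a co-point): the transposition of `i = max (a smallest)` and `j = min (rest)` reverses the outcome on the flip set, counted by
slicing over the larger of the two free parts and binomial equidistribution mod `3p` (Literature `TwoModuli.abs_card_filter_card_eq_sub_le'`). -/

section Law

variable {n : ℕ}

/-! #### 3.1 fibres of a coordinate block, gluing, and counting inside a fibre -/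

/-- the words agreeing with `z` off `A`. -/
def fib (A : Finset (Fin n)) (z : Fin n → Bool) : Finset (Fin n → Bool) :=
  univ.filter fun u => ∀ k, k ∉ A → u k = z k

/-- glue the bits `v` on `A` into the word `z`. -/
def glue (A : Finset (Fin n)) (z : Fin n → Bool) (v : A → Bool) : Fin n → Bool :=
  fun k => if h : k ∈ A then v ⟨k, h⟩ else z k

/-- Membership in the fibre `fib A z`: the word agrees with `z` off `A`. -/
theorem mem_fib {A : Finset (Fin n)} {z u : Fin n → Bool} : u ∈ fib A z ↔ ∀ k, k ∉ A → u k = z k := by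
  simp [fib]

/-- On `A` the glued word `glue A z v` reads the block bits `v`. -/
theorem glue_apply_mem (A : Finset (Fin n)) (z : Fin n → Bool) (v : A → Bool) {k : Fin n} (hk : k ∈ A) :
    glue A z v k = v ⟨k, hk⟩ := by
  simp [glue, hk]

/-- Off `A` the glued word `glue A z v` reads the outside word `z`. -/
theorem glue_apply_not_mem (A : Finset (Fin n)) (z : Fin n → Bool) (v : A → Bool) {k : Fin n} (hk : k ∉ A) :
    glue A z v k = z k := by
  simp [glue, hk]

/-- A glued word lies in the fibre of its outside word. -/
theorem glue_mem_fib (A : Finset (Fin n)) (z : Fin n → Bool) (v : A → Bool) : glue A z v ∈ fib A z :=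
  mem_fib.2 fun _ hk => glue_apply_not_mem A z v hk

/-- Gluing back the restriction to `A` of a fibre element returns the element. -/
theorem glue_restrict {A : Finset (Fin n)} {z u : Fin n → Bool} (hu : u ∈ fib A z) :
    glue A z (fun a : A => u a.1) = u := by
  funext k
  by_cases hk : k ∈ A
  · rw [glue_apply_mem A z _ hk]
  · rw [glue_apply_not_mem A z _ hk, (mem_fib.1 hu) k hk]

/-- ★ counting in a fibre is counting on the cube `A → Bool`. -/
theorem card_filter_fib (A : Finset (Fin n)) (z : Fin n → Bool) (P : (Fin n → Bool) → Prop) [DecidablePred P] :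
    ((fib A z).filter P).card = (univ.filter fun v : A → Bool => P (glue A z v)).card := by
  refine Finset.card_bij' (fun u _ => fun a : A => u a.1) (fun v _ => glue A z v) ?_ ?_ ?_ ?_
  · intro u hu
    rw [Finset.mem_filter] at hu ⊢
    exact ⟨Finset.mem_univ _, by rw [glue_restrict hu.1]; exact hu.2⟩
  · intro v hv
    rw [Finset.mem_filter] at hv ⊢
    exact ⟨glue_mem_fib A z v, hv.2⟩
  · intro u hu
    exact glue_restrict (Finset.mem_filter.1 hu).1
  · intro v _
    funext a
    show glue A z v a.1 = v a
    rw [glue_apply_mem A z v a.2]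

/-- A fibre over the block `A` has exactly `2 ^ |A|` elements. -/
theorem card_fib (A : Finset (Fin n)) (z : Fin n → Bool) : (fib A z).card = 2 ^ A.card := by
  have h := card_filter_fib A z (fun _ => True)
  rw [Finset.filter_true_of_mem (fun _ _ => trivial), Finset.filter_true_of_mem (fun _ _ => trivial)] at h
  rw [h, Finset.card_univ, Fintype.card_fun, Fintype.card_bool, Fintype.card_coe]

/-- Counting a predicate on `A` equals counting it on the subtype of `A`. -/
private theorem card_filter_eq_card_subtype (A : Finset (Fin n)) (q : Fin n → Prop) [DecidablePred q] :
    (A.filter q).card = (univ.filter fun a : A => q a.1).card := by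
  refine Finset.card_bij' (fun k hk => ⟨k, (Finset.mem_filter.1 hk).1⟩) (fun a _ => a.1) ?_ ?_ ?_ ?_
  · intro k hk; exact Finset.mem_filter.2 ⟨Finset.mem_univ _, (Finset.mem_filter.1 hk).2⟩
  · intro a ha; exact Finset.mem_filter.2 ⟨a.2, (Finset.mem_filter.1 ha).2⟩
  · intro k _; rfl
  · intro a _; rfl

/-- The block weight on `A` of a glued word is the number of `true` block bits. -/
theorem bw_glue_self (A : Finset (Fin n)) (z : Fin n → Bool) (v : A → Bool) :
    SubChar.bw A (glue A z v) = (univ.filter fun a : A => v a = true).card := by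
  unfold SubChar.bw
  rw [card_filter_eq_card_subtype]
  congr 1
  refine Finset.filter_congr fun a _ => ?_
  rw [glue_apply_mem A z v a.2]

/-- The block weight on a singleton `{i}` is the bit `u i`. -/
theorem bw_singleton (i : Fin n) (u : Fin n → Bool) : SubChar.bw {i} u = if u i = true then 1 else 0 := by
  unfold SubChar.bw
  rw [Finset.filter_singleton]
  split_ifs <;> simp

/-- ★ equidistribution of the block weight inside a fibre (the Literature bound transported along the gluing). -/
theorem fib_weight_class_ge (A : Finset (Fin n)) (z : Fin n → Bool) {N : ℕ} (hN : 2 ≤ N) (w : ℕ) :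
    (2 : ℝ) ^ A.card / N - (2 * Real.cos (Real.pi / N)) ^ A.card ≤
      (((fib A z).filter fun u => SubChar.bw A u ≡ w [MOD N]).card : ℝ) := by
  haveI : NeZero N := ⟨by omega⟩
  rw [card_filter_fib]
  have hset : (univ.filter fun v : A → Bool => SubChar.bw A (glue A z v) ≡ w [MOD N]) =
      univ.filter fun v : A → Bool => ((univ.filter fun a => v a = true).card : ZMod N) = ((w : ℕ) : ZMod N) := by
    refine Finset.filter_congr fun v _ => ?_
    rw [bw_glue_self, ZMod.natCast_eq_natCast_iff]
  rw [hset]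
  have h := Literature.Computability.MetaComplexity.TwoModuli.abs_card_filter_card_eq_sub_le' (ι := (A : Type)) hN ((w : ℕ) : ZMod N)
  rw [Fintype.card_coe] at h
  have h2 := (abs_sub_le_iff.1 h).2
  linarith

/-- ★ two moduli: a prescribed residue mod `p` AND mod `3` (CRT, `3 ⟂ p`). -/
theorem fib_two_moduli_ge {p : ℕ} (hp : 1 ≤ p) (h3p : Nat.Coprime 3 p) (A : Finset (Fin n)) (z : Fin n → Bool)
    (a : ZMod p) (b : ZMod 3) :
    (2 : ℝ) ^ A.card / (3 * p) - (2 * Real.cos (Real.pi / (3 * p))) ^ A.card ≤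
      (((fib A z).filter fun u =>
        ((SubChar.bw A u : ℕ) : ZMod p) = a ∧ ((SubChar.bw A u : ℕ) : ZMod 3) = b).card : ℝ) := by
  haveI : NeZero p := ⟨by omega⟩
  obtain ⟨w, hw3, hwp⟩ := Nat.chineseRemainder h3p b.val a.val
  have hsub : ((fib A z).filter fun u => SubChar.bw A u ≡ w [MOD 3 * p]) ⊆
      ((fib A z).filter fun u =>
        ((SubChar.bw A u : ℕ) : ZMod p) = a ∧ ((SubChar.bw A u : ℕ) : ZMod 3) = b) := by
    intro u hu
    rw [Finset.mem_filter] at hu ⊢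
    refine ⟨hu.1, ?_, ?_⟩
    · have h1 : SubChar.bw A u ≡ a.val [MOD p] := (hu.2.of_mul_left 3).trans hwp
      rw [(ZMod.natCast_eq_natCast_iff _ _ _).2 h1, ZMod.natCast_zmod_val]
    · have h1 : SubChar.bw A u ≡ b.val [MOD 3] := (hu.2.of_mul_right p).trans hw3
      rw [(ZMod.natCast_eq_natCast_iff _ _ _).2 h1, ZMod.natCast_zmod_val]
  have hN : 2 ≤ 3 * p := by omega
  have h := fib_weight_class_ge A z hN w
  have hc : (((fib A z).filter fun u => SubChar.bw A u ≡ w [MOD 3 * p]).card : ℝ) ≤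
      (((fib A z).filter fun u =>
        ((SubChar.bw A u : ℕ) : ZMod p) = a ∧ ((SubChar.bw A u : ℕ) : ZMod 3) = b).card : ℝ) := by
    exact_mod_cast Finset.card_le_card hsub
  push_cast at h
  linarith

/-- … and AVOIDING one residue mod `3` (two good classes). -/
theorem fib_two_moduli_ne_ge {p : ℕ} (hp : 1 ≤ p) (h3p : Nat.Coprime 3 p) (A : Finset (Fin n)) (z : Fin n → Bool)
    (a : ZMod p) (b : ZMod 3) :
    2 * ((2 : ℝ) ^ A.card / (3 * p) - (2 * Real.cos (Real.pi / (3 * p))) ^ A.card) ≤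
      (((fib A z).filter fun u =>
        ((SubChar.bw A u : ℕ) : ZMod p) = a ∧ ((SubChar.bw A u : ℕ) : ZMod 3) ≠ b).card : ℝ) := by
  have hne12 : ∀ x b : ZMod 3, x = b + 1 → x = b + 2 → False := by decide
  have hne1 : ∀ x b : ZMod 3, x = b + 1 → x ≠ b := by decide
  have hne2 : ∀ x b : ZMod 3, x = b + 2 → x ≠ b := by decide
  have h1 := fib_two_moduli_ge hp h3p A z a (b + 1)
  have h2 := fib_two_moduli_ge hp h3p A z a (b + 2)
  set T1 := (fib A z).filter fun u => ((SubChar.bw A u : ℕ) : ZMod p) = a ∧ ((SubChar.bw A u : ℕ) : ZMod 3) = b + 1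
    with hT1
  set T2 := (fib A z).filter fun u => ((SubChar.bw A u : ℕ) : ZMod p) = a ∧ ((SubChar.bw A u : ℕ) : ZMod 3) = b + 2
    with hT2
  have hdisj : Disjoint T1 T2 := by
    rw [Finset.disjoint_left]
    intro u hu1 hu2
    exact hne12 _ b (Finset.mem_filter.1 hu1).2.2 (Finset.mem_filter.1 hu2).2.2
  have hsub : T1 ∪ T2 ⊆ ((fib A z).filter fun u =>
      ((SubChar.bw A u : ℕ) : ZMod p) = a ∧ ((SubChar.bw A u : ℕ) : ZMod 3) ≠ b) := by
    intro u hu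
    rw [Finset.mem_union] at hu
    rw [Finset.mem_filter]
    rcases hu with hu | hu
    · have h := Finset.mem_filter.1 hu; exact ⟨h.1, h.2.1, hne1 _ b h.2.2⟩
    · have h := Finset.mem_filter.1 hu; exact ⟨h.1, h.2.1, hne2 _ b h.2.2⟩
  have hc := Finset.card_le_card hsub
  rw [Finset.card_union_of_disjoint hdisj] at hc
  have hc' : (T1.card : ℝ) + (T2.card : ℝ) ≤ (((fib A z).filter fun u =>
      ((SubChar.bw A u : ℕ) : ZMod p) = a ∧ ((SubChar.bw A u : ℕ) : ZMod 3) ≠ b).card : ℝ) := by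
    exact_mod_cast hc
  linarith

/-- zero the bits on `A` (the key of a slice). -/
def zeroOn (A : Finset (Fin n)) (u : Fin n → Bool) : Fin n → Bool := fun k => if k ∈ A then false else u k

/-- If `w` vanishes on `A`, zeroing any element of `fib A w` on `A` returns `w`. -/
theorem zeroOn_eq_of_mem_fib {A : Finset (Fin n)} {w u : Fin n → Bool} (hw : ∀ k ∈ A, w k = false)
    (hu : u ∈ fib A w) : zeroOn A u = w := by
  funext k
  unfold zeroOn
  by_cases hk : k ∈ A
  · rw [if_pos hk, hw k hk]
  · rw [if_neg hk, (mem_fib.1 hu) k hk]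

/-- ★ SLICE COUNTING: if for every key `w ∈ K` (vanishing on `A`) the slice `fib A w` contributes all words with a prescribed residue
mod `p` and a non-forbidden residue mod `3` of the weight on `A`, then `F` has at least `|K| · 2(2^{|A|}/3p − (2cos(π/3p))^{|A|})` elements. -/
theorem card_ge_of_slices {p : ℕ} (hp : 1 ≤ p) (h3p : Nat.Coprime 3 p) (A : Finset (Fin n))
    (K F : Finset (Fin n → Bool)) (hK : ∀ w ∈ K, ∀ k ∈ A, w k = false)
    (hslice : ∀ w ∈ K, ∃ (a : ZMod p) (b : ZMod 3), ∀ u ∈ fib A w,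
      ((SubChar.bw A u : ℕ) : ZMod p) = a → ((SubChar.bw A u : ℕ) : ZMod 3) ≠ b → u ∈ F) :
    (K.card : ℝ) * (2 * ((2 : ℝ) ^ A.card / (3 * p) - (2 * Real.cos (Real.pi / (3 * p))) ^ A.card)) ≤ (F.card : ℝ) := by
  have hfib : ∑ w ∈ K, (F.filter fun u => zeroOn A u = w).card ≤ F.card := by
    rw [Finset.sum_card_fiberwise_eq_card_filter]
    exact Finset.card_filter_le _ _
  have hterm : ∀ w ∈ K, 2 * ((2 : ℝ) ^ A.card / (3 * p) - (2 * Real.cos (Real.pi / (3 * p))) ^ A.card) ≤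
      ((F.filter fun u => zeroOn A u = w).card : ℝ) := by
    intro w hw
    obtain ⟨a, b, h⟩ := hslice w hw
    refine (fib_two_moduli_ne_ge hp h3p A w a b).trans ?_
    have hsub : ((fib A w).filter fun u =>
        ((SubChar.bw A u : ℕ) : ZMod p) = a ∧ ((SubChar.bw A u : ℕ) : ZMod 3) ≠ b) ⊆
        (F.filter fun u => zeroOn A u = w) := by
      intro u hu
      rw [Finset.mem_filter] at hu ⊢
      exact ⟨h u hu.1 hu.2.1 hu.2.2, zeroOn_eq_of_mem_fib (hK w hw) hu.1⟩
    exact_mod_cast Finset.card_le_card hsub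
  calc (K.card : ℝ) * (2 * ((2 : ℝ) ^ A.card / (3 * p) - (2 * Real.cos (Real.pi / (3 * p))) ^ A.card))
      = ∑ _w ∈ K, 2 * ((2 : ℝ) ^ A.card / (3 * p) - (2 * Real.cos (Real.pi / (3 * p))) ^ A.card) := by
        rw [Finset.sum_const, nsmul_eq_mul]
    _ ≤ ∑ w ∈ K, ((F.filter fun u => zeroOn A u = w).card : ℝ) := Finset.sum_le_sum hterm
    _ ≤ F.card := by exact_mod_cast hfib

/-- the keys: words of a fibre with two prescribed unequal bits are exactly half of it. -/
theorem two_mul_card_fib_filter_ne (B : Finset (Fin n)) (z : Fin n → Bool) {i j : Fin n} (hi : i ∈ B)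
    (hij : i ≠ j) : 2 * ((fib B z).filter fun w => w i ≠ w j).card = 2 ^ B.card := by
  have hφ : ∀ w ∈ fib B z, Function.update w i (!w i) ∈ fib B z := by
    intro w hw
    rw [mem_fib] at hw ⊢
    intro k hk
    have hki : k ≠ i := by rintro rfl; exact hk hi
    rw [Function.update_of_ne hki, hw k hk]
  have hinv : ∀ w : Fin n → Bool, Function.update (Function.update w i (!w i)) i (!(Function.update w i (!w i) i)) = w := by
    intro w
    funext k
    by_cases hk : k = i
    · subst hk; simp
    · simp [Function.update_of_ne hk]
  have heq : ((fib B z).filter fun w => w i = w j).card = ((fib B z).filter fun w => w i ≠ w j).card := by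
    refine Finset.card_bij' (fun w _ => Function.update w i (!w i)) (fun w _ => Function.update w i (!w i)) ?_ ?_ ?_ ?_
    · intro w hw
      rw [Finset.mem_filter] at hw ⊢
      refine ⟨hφ w hw.1, ?_⟩
      rw [Function.update_self, Function.update_of_ne hij.symm, ← hw.2]
      cases w i <;> decide
    · intro w hw
      rw [Finset.mem_filter] at hw ⊢
      refine ⟨hφ w hw.1, ?_⟩
      rw [Function.update_self, Function.update_of_ne hij.symm]
      have h2 := hw.2
      revert h2
      cases w i <;> cases w j <;> decide
    · intro w _; exact hinv w
    · intro w _; exact hinv w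
  have hsum := Finset.card_filter_add_card_filter_not (s := fib B z) (fun w : Fin n → Bool => w i = w j)
  rw [card_fib, heq] at hsum
  have : ((fib B z).filter fun w => ¬ w i = w j) = ((fib B z).filter fun w => w i ≠ w j) := rfl
  rw [this] at hsum
  omega

end Law

end Summit.QuantumAdvantage.QuantumAdvantage.Theorems.ColumnDial
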